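import Summits.HubbardSuperconductivity.HubbardSuperconductivity.Theses.KLProgramme
import Summits.HubbardSuperconductivity.HubbardSuperconductivity.Theorems.KLProgrammeH10TwoPointLimitOfChildrenV5

/-!
K1 SKELETON v4 «children, re-keyed» (lead leafhand-hubbard-klprogramme-2 g0, 2026-08-30; INFORMATIONAL re-key of v3 a42510dafcf4f866 of
stmt-HubbardSuperconductivity-19938 — NOT the registered skeleton: under the custody terms of director-hubbard g23 (KL INBOX l.334 (1),
«no re-registration of any skeleton/stub by visitors») the REGISTERED stub set of record stays v3's; this file was registered 22:55Z and
the registration REVERTED to v3 at 23:04:52Z; it is stored here for the pen/director as the truthful re-point candidate): v3's two stubs named the gen-6 children `KLRegimeEngineV16` / `KLRegimeVolumeLimitV16`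
(items 20236 / 20239), RETIRED at the gen-7/8 resplits of K3 (route rev 24); the children of record are the gen-8 ones on the cured
flow bundle `klPredsV17F2`, of which `KLRegimeBetaSplitV17F2` (20438), `KLRegimeRenormFlowV17F2` (20439) and
`KLRegimeTwoPointAssemblyV17F2` (20441) are CLOSED, and the two OPEN ones are the route items 20437 `KLRegimeEngineV17F2` and 23356
`KLRegimeVolumeLimitV17F3` (volume-limit child re-keyed under `R.WF2`, `VolumeLimitP3`).  They are named here BY THEIR ROUTE DECLS as
the two stubs (open remainder of K1 = exactly 20437 ∧ 23356 = K3's open remainder = the cone of `closes` rev 24); the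
composition is the landed `KLRegimeSplit.H10TwoPointLimit_of_liveChildren` (p793604, `…Theorems.KLProgrammeH10TwoPointLimitOfChildrenV5`:
`fullRange_inductionP5` → all temperatures with the CLOSED compact box → K1 with `a := c`).  Sorries ONLY in the two `stub_*`; the
composition concludes the crux BY NAME.  Pure bookkeeping; nothing here proves a child or asserts anything about the Hubbard model.
-/

namespace Summit.HubbardSuperconductivity.HubbardSuperconductivity.Cruxes.H10TwoPointLimit.Children

set_option linter.dupNamespace false

/-- **STUB 1 (OPEN = route item 20437, the deciding child of K3):** the gen-8 ENGINE child
`KLRegimeEngineV17F2 := EngineP4 klPredsV17F2 klWindowC` (skeleton of record 27cd7ed0f55f17c0, p1b g17; open registered stubs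
stub_twoLeg_curvature · stub_engine_exports · stub_engine_step_norms · stub_engine_step_values · stub_twoLeg_step). -/
theorem stub_k1_engineV17F2 :
    Summit.HubbardSuperconductivity.HubbardSuperconductivity.Theses.KLProgramme.KLRegimeEngineV17F2 := by
  sorry

/-- **STUB 2 (OPEN = route item 23356):** the re-keyed VOLUME-LIMIT child
`KLRegimeVolumeLimitV17F3 := VolumeLimitP3 klPredsV17F2 FinalTwoLegVolLimitEx klWindowC` (skeleton of record 3fe75b6ca60710d7,
k3c4-p1 g20; open registered stubs stub_vl_HE1free · stub_vl_flowPieceOscTE). -/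
theorem stub_k1_volumeLimitV17F3 :
    Summit.HubbardSuperconductivity.HubbardSuperconductivity.Theses.KLProgramme.KLRegimeVolumeLimitV17F3 := by
  sorry

/-- **COMPOSITION — concludes crux K1 `H10TwoPointLimit` BY NAME** from the two open children (stubs); the three CLOSED children are
supplied inside `KLRegimeSplit.H10TwoPointLimit_of_liveChildren` by their landed closers. -/
theorem H10TwoPointLimit_of :
    Summit.HubbardSuperconductivity.HubbardSuperconductivity.Theses.KLProgramme.H10TwoPointLimit :=
  Summit.HubbardSuperconductivity.HubbardSuperconductivity.Theorems.KLRegimeSplit.H10TwoPointLimit_of_liveChildren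
    stub_k1_engineV17F2 stub_k1_volumeLimitV17F3

end Summit.HubbardSuperconductivity.HubbardSuperconductivity.Cruxes.H10TwoPointLimit.Children
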